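import Literature.Analysis.FluidPDE.CheskidovDaiOccupationCriterion
import Literature.Analysis.FluidPDE.LerayHopfBoundedContinuation
import Mathlib.Topology.Algebra.Order.LiminfLimsup

/-!
# Fluid computer — the level-occupation (clock) floor on EVERY TERMINAL WINDOW, conditional on
# Cheskidov–Dai's criterion in its as-printed form (rung R2/R3; pub-fluidc-lit gen 37)

HONEST FRAMING (cell `pub-fluidc`, verbatim): *low prior, high value-of-information experiment on Tao's
machine paradigm; NOT a claim that NS blows up.*

`Summits/NavierStokesRegularity/FluidComputer/LevelOccupationFloor.lean` reads Cheskidov–Dai's low-mode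
criterion (tree fact `Literature.Analysis.FluidPDE.cheskidov_dai_occupation`, house rendering) as a CLOCK
NECESSITY on the last half `(T/2, T)` of the lifespan. That rendering carries `HasRapidSpatialDecay (u 0)`,
which does not survive a restart at `t₀ > 0`, so the floor could not be moved to terminal windows
(flagged by the cell's p2 seat, STATUS 2026-08-23 09:05Z). The AS-PRINTED rendering
`Literature.Analysis.FluidPDE.cheskidov_dai_occupation_regular` (Leray–Hopf weak solution on `[0,T]`,
`H¹`-regular on `(0,T)`, occupation `≤ c` `⇒` `H¹`-regular on `(0,T]`) has hypotheses that restrict to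
subintervals and survive Leray–Hopf restarts (tree `IsLerayHopfOn.exists_isLerayHopfOn_restart_Ioo`,
`IsH1RegularOn.comp_add_right`), and this file draws the consequence, CONDITIONALLY on that named fact
(hypothesis `h : cheskidov_dai_occupation_regular`; nothing smuggled):

* `isH1RegularOn_Ioc_of_restart` (unconditional bookkeeping) — if `u` is `H¹`-regular on `(0,T)` and a
  restart `u(· + t₁)`, `0 < t₁ < T`, is `H¹`-regular on `(0, T - t₁]`, then `u` is `H¹`-regular on `(0,T]`;
* `occupation_comp_add_right` — the occupation integral of the restart over a window is the occupation
  integral of `u` over the translated window;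
* `occupation_floor_window` — for `u` Leray–Hopf on `[0,T]` from `u₀`, `H¹`-regular on `(0,T)` but NOT
  on `(0,T]` (`T` is an epoch of irregularity), and EVERY `s ∈ [0,T)`:
  `c < limsup_{q → ∞} ∫_{(s,T)} 1_{Λ_{c,ν}(u(t)) ≥ 2^q} 2^q ‖Δ̇_q u(t)‖_∞ dt` — the occupation floor holds
  on every terminal window, i.e. the occupation of a blow-up is not a transient of `(T/2,T)` but
  concentrates at `T`;
* `frequently_occupation_window_gt` — the same as `∃ᶠ q, c < ∫_{(s,T)} …`.

The bridge from the cell's `IsMaximalSmoothSolution` (classical, rapidly decaying datum) to the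
hypotheses here (`H¹`-regular on `(0,T)`, not on `(0,T]`) is local strong-solution theory and is NOT
restated in this file (p2's call).

## References

* A. Cheskidov, M. Dai, arXiv:1507.06611 = Proc. Edinburgh Math. Soc. (2025),
  doi:10.1017/s0013091525100813, Thm. 1.1, Defs. 2.5–2.6. [CheskidovDai2015]
* J. C. Robinson, J. L. Rodrigo, W. Sadowski, *The three-dimensional Navier–Stokes equations*, CUP
  2016, Ch. 8 p. 121 (restarting a Leray–Hopf solution at a good time). [RobinsonRodrigoSadowski2016]
-/

noncomputable section

open MeasureTheory Set Function Filter Topology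
open scoped ENNReal NNReal
open Literature.Analysis.FluidPDE Literature.Analysis.FunctionSpaces

namespace Summit.NavierStokesRegularity.FluidComputer.LevelOccupationWindow

/-! ## Bookkeeping: regularity of a restart, translated occupation integrals -/

/-- If `u` is `H¹`-regular on `(0,T)` and the restart `u(· + t₁)` (`0 < t₁ < T`) is `H¹`-regular on
`(0, T - t₁]`, then `u` is `H¹`-regular on `(0,T]` (continuity at `T` from the restart, elsewhere from
`u`). [folklore] -/
theorem isH1RegularOn_Ioc_of_restart {T t₁ : ℝ}
    {u : ℝ → EuclideanSpace ℝ (Fin 3) → EuclideanSpace ℝ (Fin 3)} (ht₁ : t₁ ∈ Ioo 0 T)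
    (hreg : IsH1RegularOn (Ioo 0 T) u) (hv : IsH1RegularOn (Ioc 0 (T - t₁)) (fun t => u (t + t₁))) :
    IsH1RegularOn (Ioc 0 T) u := by
  -- the restart's regularity, translated back to `u` on `(t₁, T]`
  have hmaps : MapsTo (fun t : ℝ => t - t₁) (Ioc t₁ T) (Ioc 0 (T - t₁)) := fun t ht =>
    ⟨by linarith [ht.1], by linarith [ht.2]⟩
  have hback : IsH1RegularOn (Ioc t₁ T) u := by
    refine ⟨fun t ht => ?_, ?_⟩
    · have := hv.1 (t - t₁) (hmaps ht)
      simpa only [sub_add_cancel] using this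
    · have hc := hv.2.comp (continuous_sub_right t₁).continuousOn hmaps
      refine hc.congr fun t _ => ?_
      simp only [Function.comp_apply, sub_add_cancel]
  refine ⟨fun t ht => ?_, fun t ht => ?_⟩
  · rcases lt_or_ge t₁ t with hlt | hge
    · exact hback.1 t ⟨hlt, ht.2⟩
    · exact hreg.1 t ⟨ht.1, lt_of_le_of_lt hge ht₁.2⟩
  · rcases lt_or_ge t₁ t with hlt | hge
    · -- `(t₁, T]` is a neighbourhood of `t` within `(0, T]`
      have hmem : Ioc t₁ T ∈ 𝓝[Ioc 0 T] t := by
        have : Ioc t₁ T = Ioc 0 T ∩ Ioi t₁ := by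
          ext τ; constructor
          · intro hτ; exact ⟨⟨ht₁.1.trans hτ.1, hτ.2⟩, hτ.1⟩
          · intro hτ; exact ⟨hτ.2, hτ.1.2⟩
        rw [this]
        exact inter_mem_nhdsWithin _ (Ioi_mem_nhds hlt)
      exact (hback.2 t ⟨hlt, ht.2⟩).mono_of_mem_nhdsWithin hmem
    · have htI : t ∈ Ioo 0 T := ⟨ht.1, lt_of_le_of_lt hge ht₁.2⟩
      exact (hreg.2.continuousAt (isOpen_Ioo.mem_nhds htI)).continuousWithinAt

/-- Change of variables `σ ↦ σ + a` in a windowed time `lintegral`: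
`∫_{(l,r)} G(σ + a) dσ = ∫_{(l+a, r+a)} G(τ) dτ`. [folklore] -/
theorem setLIntegral_Ioo_comp_add_right (G : ℝ → ℝ≥0∞) (a l r : ℝ) :
    ∫⁻ σ in Ioo l r, G (σ + a) = ∫⁻ τ in Ioo (l + a) (r + a), G τ := by
  rw [← lintegral_indicator measurableSet_Ioo, ← lintegral_indicator measurableSet_Ioo]
  have h : (fun σ => (Ioo l r).indicator (fun σ => G (σ + a)) σ) =
      fun σ => (Ioo (l + a) (r + a)).indicator G (σ + a) := by
    funext σ
    simp only [indicator, mem_Ioo]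
    by_cases hσ : l < σ ∧ σ < r
    · rw [if_pos hσ, if_pos ⟨by linarith [hσ.1], by linarith [hσ.2]⟩]
    · rw [if_neg hσ, if_neg (fun h' => hσ ⟨by linarith [h'.1], by linarith [h'.2]⟩)]
  rw [h]
  exact lintegral_add_right_eq_self (μ := (volume : Measure ℝ))
    (fun τ => (Ioo (l + a) (r + a)).indicator G τ) a

/-- **The occupation integral of a restart is a translated occupation integral of `u`.** [folklore] -/
theorem occupation_comp_add_right (c ν : ℝ) (u : ℝ → EuclideanSpace ℝ (Fin 3) → EuclideanSpace ℝ (Fin 3))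
    (t₁ l r : ℝ) (q : ℕ) :
    (∫⁻ σ in Ioo l r, {σ | (2 : ℝ≥0∞) ^ q ≤ dissipationWavenumber c ν (u (σ + t₁))}.indicator
        (fun σ => (2 : ℝ≥0∞) ^ q * eLpNorm (blockFn (q : ℤ) (u (σ + t₁))) ∞ volume) σ) =
      ∫⁻ τ in Ioo (l + t₁) (r + t₁), {τ | (2 : ℝ≥0∞) ^ q ≤ dissipationWavenumber c ν (u τ)}.indicator
        (fun τ => (2 : ℝ≥0∞) ^ q * eLpNorm (blockFn (q : ℤ) (u τ)) ∞ volume) τ := by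
  rw [← setLIntegral_Ioo_comp_add_right
    (fun τ => {τ | (2 : ℝ≥0∞) ^ q ≤ dissipationWavenumber c ν (u τ)}.indicator
      (fun τ => (2 : ℝ≥0∞) ^ q * eLpNorm (blockFn (q : ℤ) (u τ)) ∞ volume) τ) t₁ l r]
  rfl

/-! ## The occupation floor on every terminal window -/

/-- **The occupation floor on every terminal window.** Conditionally on
`cheskidov_dai_occupation_regular`: with an absolute `c > 0`, for every `ν > 0`, `T > 0`, every
Leray–Hopf weak solution `u` on `[0,T]` from `u₀` which is `H¹`-regular on `(0,T)` but NOT on `(0,T]`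
(`T` is an epoch of irregularity), and EVERY `s ∈ [0,T)`:
`c < limsup_{q → ∞} ∫_{(s,T)} 1_{Λ_{c,ν}(u(t)) ≥ 2^q} · 2^q ‖Δ̇_q u(t)‖_∞ dt`.
Proof: restart at a good time `t₁ ∈ (s, T)` (`IsLerayHopfOn.exists_isLerayHopfOn_restart_Ioo`); the
restart is `H¹`-regular on `(0, T - t₁)` (`IsH1RegularOn.comp_add_right`) and cannot be `H¹`-regular on
`(0, T - t₁]` (`isH1RegularOn_Ioc_of_restart`), so its occupation on `((T-t₁)/2, T-t₁)` exceeds `c`;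
that window is `((t₁+T)/2, T) ⊆ (s, T)` for `u`. [cite: CheskidovDai2015, §1 Thm. 1.1] -/
theorem occupation_floor_window (h : cheskidov_dai_occupation_regular) :
    ∃ c : ℝ, 0 < c ∧ ∀ (ν T : ℝ), 0 < ν → 0 < T →
      ∀ (u₀ : EuclideanSpace ℝ (Fin 3) → EuclideanSpace ℝ (Fin 3))
        (u : ℝ → EuclideanSpace ℝ (Fin 3) → EuclideanSpace ℝ (Fin 3)),
      IsLerayHopfOn T ν 0 u₀ u → IsH1RegularOn (Ioo 0 T) u → ¬ IsH1RegularOn (Ioc 0 T) u →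
      ∀ s ∈ Ico 0 T, ENNReal.ofReal c <
        limsup (fun q : ℕ => ∫⁻ τ in Ioo s T,
          {τ | (2 : ℝ≥0∞) ^ q ≤ dissipationWavenumber c ν (u τ)}.indicator
            (fun τ => (2 : ℝ≥0∞) ^ q * eLpNorm (blockFn (q : ℤ) (u τ)) ∞ volume) τ) atTop := by
  obtain ⟨c, hc, H⟩ := h
  refine ⟨c, hc, fun ν T hν hT u₀ u hLH hreg hnot s hs => ?_⟩
  -- a good restarting time in `(s, T)`
  obtain ⟨t₁, ht₁, hLH₁⟩ := hLH.exists_isLerayHopfOn_restart_Ioo hν.le hs.1 hs.2 le_rfl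
  have ht₁T : t₁ ∈ Ioo 0 T := ⟨hs.1.trans_lt ht₁.1, ht₁.2⟩
  have hT₁ : 0 < T - t₁ := sub_pos.2 ht₁.2
  -- the restart is regular on the open interval, not on the half-closed one
  have hreg₁ : IsH1RegularOn (Ioo 0 (T - t₁)) (fun t => u (t + t₁)) := by
    have h' := hreg.comp_add_right t₁
    rw [zero_sub] at h'
    exact h'.mono (Ioo_subset_Ioo (by linarith [ht₁T.1]) le_rfl)
  have hnot₁ : ¬ IsH1RegularOn (Ioc 0 (T - t₁)) (fun t => u (t + t₁)) := fun hv =>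
    hnot (isH1RegularOn_Ioc_of_restart ht₁T hreg hv)
  -- hence the occupation of the restart exceeds `c`
  have hocc := mt (H ν (T - t₁) hν hT₁ (u t₁) (fun t => u (t + t₁)) hLH₁ hreg₁) hnot₁
  rw [not_le] at hocc
  refine hocc.trans_le ?_
  -- translate the window back to `u` and enlarge it to `(s, T)`
  refine limsup_le_limsup (Eventually.of_forall fun q => ?_)
  dsimp only
  rw [occupation_comp_add_right]
  refine lintegral_mono_set (Ioo_subset_Ioo ?_ ?_)
  · linarith [ht₁.1, ht₁.2]
  · linarith

/-- **Frequently-large windowed occupation**: in the setting of `occupation_floor_window`, for every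
`s ∈ [0,T)` the occupation `∫_{(s,T)} 1_{Λ ≥ 2^q} 2^q ‖Δ̇_q u‖_∞` exceeds `c` at infinitely many levels
`q`. [cite: CheskidovDai2015, §1 Thm. 1.1] -/
theorem frequently_occupation_window_gt (h : cheskidov_dai_occupation_regular) :
    ∃ c : ℝ, 0 < c ∧ ∀ (ν T : ℝ), 0 < ν → 0 < T →
      ∀ (u₀ : EuclideanSpace ℝ (Fin 3) → EuclideanSpace ℝ (Fin 3))
        (u : ℝ → EuclideanSpace ℝ (Fin 3) → EuclideanSpace ℝ (Fin 3)),
      IsLerayHopfOn T ν 0 u₀ u → IsH1RegularOn (Ioo 0 T) u → ¬ IsH1RegularOn (Ioc 0 T) u →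
      ∀ s ∈ Ico 0 T, ∃ᶠ q : ℕ in atTop, ENNReal.ofReal c <
        ∫⁻ τ in Ioo s T, {τ | (2 : ℝ≥0∞) ^ q ≤ dissipationWavenumber c ν (u τ)}.indicator
          (fun τ => (2 : ℝ≥0∞) ^ q * eLpNorm (blockFn (q : ℤ) (u τ)) ∞ volume) τ := by
  obtain ⟨c, hc, H⟩ := occupation_floor_window h
  exact ⟨c, hc, fun ν T hν hT u₀ u hLH hreg hnot s hs =>
    frequently_lt_of_lt_limsup (by isBoundedDefault) (H ν T hν hT u₀ u hLH hreg hnot s hs)⟩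

end Summit.NavierStokesRegularity.FluidComputer.LevelOccupationWindow

end
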